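import Mathlib

/-! # Route CapacityClassicality — tame coefficients agree (stub for crux stmt-Langlands-8927, line Sketch)

Two normalised `q`-coefficient sequences `b`, `b'` (`b 1 = b' 1 = 1`) that satisfy the exact
`T_ℓ`-eigen relation (in `q`-expansion form) with the *same* eigenvalues `lam ℓ` for every prime
`ℓ ∤ N p` agree at every index `n` coprime to `N p`.  Pure algebra: strong induction on `n`,
peeling off one prime factor `ℓ ∣ n` at a time with the `T_ℓ`-relation.
-/

set_option linter.dupNamespace false -- `Summit.Langlands.Langlands` is the mandated namespace

namespace Summit.Langlands.Langlands.Theorems.CapacityClassicality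

/-- **Tame coefficients agree.** If `b 1 = b' 1 = 1` and both `b` and `b'` satisfy the exact
`T_ℓ`-eigen relation `c (ℓ n) + [ℓ ∣ n] ψ ℓ ℓ^(k-1) c (n / ℓ) = lam ℓ * c n` for every prime
`ℓ ∤ N p` and every `n > 0`, with the same eigenvalues `lam ℓ`, then `b n = b' n` for every `n > 0`
coprime to `N p`.  Proof: strong induction on `n`; for `n = ℓ n₁` with `ℓ` prime (so `ℓ ∤ N p`),
apply both relations at `n₁` and use the induction hypothesis at `n₁` and, when `ℓ ∣ n₁`, at
`n₁ / ℓ`. [folklore] -/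
theorem tame_coeff_eq (N p : ℕ) (k : ℤ) (ψ : DirichletCharacter ℂ N) (lam b b' : ℕ → ℂ)
    (h1 : b 1 = 1) (h1' : b' 1 = 1)
    (hT : ∀ ℓ n : ℕ, ℓ.Prime → ¬ ℓ ∣ N * p → 0 < n →
      b (ℓ * n) + (if ℓ ∣ n then ψ ℓ * (ℓ : ℂ) ^ (k - 1) * b (n / ℓ) else 0) = lam ℓ * b n)
    (hT' : ∀ ℓ n : ℕ, ℓ.Prime → ¬ ℓ ∣ N * p → 0 < n →
      b' (ℓ * n) + (if ℓ ∣ n then ψ ℓ * (ℓ : ℂ) ^ (k - 1) * b' (n / ℓ) else 0) = lam ℓ * b' n) :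
    ∀ n : ℕ, 0 < n → Nat.Coprime n (N * p) → b n = b' n := by
  intro n hn hcop
  induction n using Nat.strong_induction_on with
  | _ n ih =>
    rcases eq_or_ne n 1 with rfl | hn1
    · rw [h1, h1']
    · obtain ⟨ℓ, hℓ, hℓn⟩ := Nat.exists_prime_and_dvd hn1
      obtain ⟨n₁, rfl⟩ := hℓn
      -- `ℓ ∤ N p` since `ℓ ∣ n` and `n` is coprime to `N p`.
      have hℓNp : ¬ ℓ ∣ N * p :=
        (Nat.Prime.coprime_iff_not_dvd hℓ).1
          (Nat.Coprime.coprime_dvd_left (dvd_mul_right ℓ n₁) hcop)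
      have hn₁ : 0 < n₁ := pos_of_mul_pos_right hn (Nat.zero_le ℓ)
      have hn₁lt : n₁ < ℓ * n₁ := lt_mul_left hn₁ hℓ.one_lt
      have hcop₁ : Nat.Coprime n₁ (N * p) :=
        Nat.Coprime.coprime_dvd_left (dvd_mul_left n₁ ℓ) hcop
      have ih₁ : b n₁ = b' n₁ := ih n₁ hn₁lt hn₁ hcop₁
      have e1 := hT ℓ n₁ hℓ hℓNp hn₁
      have e2 := hT' ℓ n₁ hℓ hℓNp hn₁
      by_cases hd : ℓ ∣ n₁
      · -- `n₁ = ℓ n₂`: both correction terms are present.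
        obtain ⟨n₂, rfl⟩ := hd
        have hn₂ : 0 < n₂ := pos_of_mul_pos_right hn₁ (Nat.zero_le ℓ)
        have hn₂lt : n₂ < ℓ * (ℓ * n₂) := (lt_mul_left hn₂ hℓ.one_lt).trans hn₁lt
        have hcop₂ : Nat.Coprime n₂ (N * p) :=
          Nat.Coprime.coprime_dvd_left ((dvd_mul_left n₂ ℓ).trans (dvd_mul_left (ℓ * n₂) ℓ)) hcop
        have ih₂ : b n₂ = b' n₂ := ih n₂ hn₂lt hn₂ hcop₂
        have hdiv₂ : ℓ * n₂ / ℓ = n₂ := Nat.mul_div_cancel_left _ hℓ.pos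
        rw [if_pos (dvd_mul_right ℓ n₂), hdiv₂] at e1 e2
        linear_combination e1 - e2 - (ψ ℓ * (ℓ : ℂ) ^ (k - 1)) * ih₂ + lam ℓ * ih₁
      · -- `ℓ ∤ n₁`: no correction terms.
        rw [if_neg hd] at e1 e2
        linear_combination e1 - e2 + lam ℓ * ih₁

/-- **Tame coefficients agree**, under the name registered for the stub of line `Sketch`
(crux `stmt-Langlands-8927`): verbatim restatement of `tame_coeff_eq`. [folklore] -/
theorem stub_tame_coeff_eq (N p : ℕ) (k : ℤ) (ψ : DirichletCharacter ℂ N) (lam b b' : ℕ → ℂ)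
    (h1 : b 1 = 1) (h1' : b' 1 = 1)
    (hT : ∀ ℓ n : ℕ, ℓ.Prime → ¬ ℓ ∣ N * p → 0 < n →
      b (ℓ * n) + (if ℓ ∣ n then ψ ℓ * (ℓ : ℂ) ^ (k - 1) * b (n / ℓ) else 0) = lam ℓ * b n)
    (hT' : ∀ ℓ n : ℕ, ℓ.Prime → ¬ ℓ ∣ N * p → 0 < n →
      b' (ℓ * n) + (if ℓ ∣ n then ψ ℓ * (ℓ : ℂ) ^ (k - 1) * b' (n / ℓ) else 0) = lam ℓ * b' n) :
    ∀ n : ℕ, 0 < n → Nat.Coprime n (N * p) → b n = b' n :=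
  tame_coeff_eq N p k ψ lam b b' h1 h1' hT hT'

end Summit.Langlands.Langlands.Theorems.CapacityClassicality
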